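import Summits.AtomisticToContinuum.HydrodynamicLimit.Theorems.OneFlightGossipEngineEnergyCurrentTailsPedigreeOrders
import Summits.AtomisticToContinuum.HydrodynamicLimit.Theorems.OneFlightGossipEngineEnergyCurrentTailsPedigreeMergeIntake
import Summits.AtomisticToContinuum.HydrodynamicLimit.Theorems.OneFlightGossipEngineEnergyCurrentTailsPedigreeAssemblyNull
import Summits.AtomisticToContinuum.HydrodynamicLimit.Theorems.OneFlightGossipEngineEnergyCurrentTailsPedigreeLedgerSure
import HarnessLib

/-!
# The merge channel of the line `pedigree-perpetuity` is census-strength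
# (crux `EnergyCurrentTails`, stmt-AtomisticToContinuum-9235)

Lead seat c3 (`prover-line-stmt-AtomisticToContinuum-9235-c3-0`), machine-checked form of the cycle-1 FINDING: for every
polynomial order `p`, the census decay of order `p` (the line's transfer statement with `L⁻⁴ ↦ L⁻ᵖ`) together with the
sure kinematic ledger of the lineage implies the merge-intake tail bound of the SAME order,

  `mergeIntakeTailsOrder_of_censusDecayOrder : ∀ p, LineageLedgerSure → CensusDecayOrder p → MergeIntakeTailsOrder p`

(registered helper).  Route: the SURE DOMINATION `Λ ≤ E_0 = ‖vᵢ(s)‖²` of the discounted warm intake by the present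
energy (`warmIntake_le_energy_zero`, landed with `mergeIntakeTails_of_gaussianCensusBound`, p120747: the perpetuity is a
telescoping identity with nonnegative brackets), the ledger clause `E_0 = ‖vᵢ(s)‖²` off the null event that `i` collides
exactly at `s` (`measure_participates_flow_eq_zero`), EXCHANGEABILITY of the local Gibbs law and label-blindness of the
flow (`card_mul_measure_level_le_eq_census`: `(N+1)·λ_N{x ≤ ‖vᵢ(s)‖²} = census(s, x)`), and the census bound at the
level `L·Θ`; at `s = 0` the event is empty.  In particular, since `stub_lineageLedgerSure` has LANDED (p121734):
`CensusDecayOrder 5 → MergeIntakeTails` and `CensusDecay → MergeIntakeTailsOrder 4` (corollaries below) — so, given the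
run statistics `NeutralRunTails`, the data facts and the ledger (through the landed `stub_censusAssembly`, which consumes
only order 4 up to constants), pricing the merge channel of this line IS proving the census: the line does not reduce the
merge channel below its own transfer statement (see the lead report `Cruxes/EnergyCurrentTails/LEAD-seat-c3-pedigree.md`).
-/

noncomputable section

open MeasureTheory Set Filter
open scoped ENNReal InnerProductSpace BigOperators

namespace Summit.AtomisticToContinuum.HydrodynamicLimit.Theorems.EnergyCurrentTailsPedigree

open Literature.MathematicalPhysics.KineticTheory Literature.Analysis.FluidPDE

variable {σ : ℝ} {N : ℕ}

/-- **One particle's level probability is the census per particle** (`≤`-level version of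
`card_mul_measure_level_eq_levelCensus`): by exchangeability of the local Gibbs law and label-blindness of the flow,
`(N+1) · λ_N{x ≤ ‖v_i(s)‖²} = census(s, x)` for every particle `i`. -/
theorem card_mul_measure_level_le_eq_census (a₀ θ₀ : T3 → ℝ) (u₀ : T3 → V3)
    (Φ : HardSphereFlow (Torus.geometry (Fin 3)) (hsDiameter σ N) (N + 1)) (s x : ℝ) (i : Fin (N + 1)) :
    ((N : ℝ≥0∞) + 1) * localGibbsLaw σ a₀ u₀ θ₀ N Φ {z | x ≤ ‖(Φ.flow s z i).2‖ ^ 2}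
      = census σ a₀ θ₀ u₀ N Φ s x := by
  have hmeasv : ∀ l : Fin (N + 1), Measurable fun z : Config (N + 1) (Fin 3) T3 => (Φ.flow s z l).2 :=
    fun l => ((measurable_pi_apply l).comp (Φ.measurable_flow s)).snd
  have hA : ∀ l : Fin (N + 1),
      MeasurableSet {z : Config (N + 1) (Fin 3) T3 | x ≤ ‖(Φ.flow s z l).2‖ ^ 2} :=
    fun l => measurableSet_le measurable_const ((hmeasv l).norm.pow_const 2)
  -- all one-particle level probabilities coincide with that of `i`
  have hswap : ∀ l : Fin (N + 1), localGibbsLaw σ a₀ u₀ θ₀ N Φ {z | x ≤ ‖(Φ.flow s z l).2‖ ^ 2}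
      = localGibbsLaw σ a₀ u₀ θ₀ N Φ {z | x ≤ ‖(Φ.flow s z i).2‖ ^ 2} := by
    intro l
    have hae : ∀ᵐ z ∂(localGibbsLaw σ a₀ u₀ θ₀ N Φ), Φ.flow s (z ∘ Equiv.swap i l)
        = (Φ.flow s z ∘ Equiv.swap i l : Config (N + 1) (Fin 3) T3) :=
      (localGibbsLaw_absolutelyContinuous σ a₀ u₀ θ₀ N Φ).ae_le
        (Φ.flow_comp_perm_ae (Equiv.swap i l) s)
    calc localGibbsLaw σ a₀ u₀ θ₀ N Φ {z | x ≤ ‖(Φ.flow s z l).2‖ ^ 2}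
        = localGibbsLaw σ a₀ u₀ θ₀ N Φ ((fun z : Config (N + 1) (Fin 3) T3 =>
            (z ∘ Equiv.swap i l : Config (N + 1) (Fin 3) T3)) ⁻¹' {z | x ≤ ‖(Φ.flow s z i).2‖ ^ 2}) := by
          refine measure_congr ?_
          filter_upwards [hae] with z hz
          change (x ≤ ‖(Φ.flow s z l).2‖ ^ 2) = (x ≤ ‖(Φ.flow s (z ∘ Equiv.swap i l) i).2‖ ^ 2)
          rw [hz, Function.comp_apply, Equiv.swap_apply_left]
      _ = localGibbsLaw σ a₀ u₀ θ₀ N Φ {z | x ≤ ‖(Φ.flow s z i).2‖ ^ 2} :=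
          (EvenStressEnskog.measurePreserving_comp_perm_localGibbsLaw σ a₀ θ₀ u₀ N Φ
            (Equiv.swap i l)).measure_preimage (hA i).nullMeasurableSet
  unfold census
  rw [lintegral_levelCount_eq_sum Φ _ s x, Finset.sum_congr rfl fun l _ => hswap l, Finset.sum_const,
    Finset.card_univ, Fintype.card_fin, nsmul_eq_mul]
  push_cast
  ring

/-- **CENSUS DECAY OF ORDER `p` GIVES MERGE-INTAKE TAILS OF ORDER `p`** (registered helper
`mergeIntakeTailsOrder_of_censusDecayOrder`; the merge channel of the line is census-strength): with `Θ₀ := Θ`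
(the census level scale), `B₁ := max B 0`, the same `N₀` and `σ₀ := min σ₀ᶜ 2⁻¹`,
`P(Λᵢ(s) ≥ LΘ) ≤ P(‖vᵢ(s)‖² ≥ LΘ) = census(s, LΘ)/(N+1) ≤ B⁺ L⁻ᵖ`. -/
theorem mergeIntakeTailsOrder_of_censusDecayOrder : ∀ p : ℕ, LineageLedgerSure → CensusDecayOrder p →
    MergeIntakeTailsOrder p := by
  intro p hL hC a₀ θ₀ u₀ ha hθ hu ha0 hθ0
  obtain ⟨σ₀, hσ₀, hCσ⟩ := hC a₀ θ₀ u₀ ha hθ hu ha0 hθ0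
  refine ⟨min σ₀ 2⁻¹, lt_min hσ₀ (by norm_num), fun σ hσ hσlt T ρ θ u hE Φ hlim t ht => ?_⟩
  have hσ2 : σ < 2⁻¹ := hσlt.trans_le (min_le_right _ _)
  obtain ⟨Θ, hΘ, B, N₀, hcen⟩ := hCσ σ hσ (hσlt.trans_le (min_le_left _ _)) T ρ θ u hE Φ hlim t ht
  refine ⟨Θ, hΘ, max B 0, N₀, fun N hN s hs i L hL1 => ?_⟩
  have hLreal : (1 : ℝ) ≤ L := by exact_mod_cast hL1
  rcases eq_or_lt_of_le hs.1 with hs0 | hs0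
  · -- `s = 0`: no transition is genuine, `Λ = 0 < L Θ`, the event is empty
    have hempty : {z : Config (N + 1) (Fin 3) T3 | (L : ℝ) * Θ
        ≤ warmIntake (hsDiameter σ N) (fun r => (Φ N).flow r z) Θ i s} = ∅ := by
      ext z
      simp only [Set.mem_setOf_eq, Set.mem_empty_iff_false, iff_false, not_le]
      rw [warmIntake_eq_zero_of_time_nonpos _ _ _ _ hs0.symm.le]
      positivity
    rw [hempty, measure_empty]
    exact bot_le
  · -- `s > 0`: sure domination off two null events, exchangeability, census bound
    have hPac : localGibbsLaw σ a₀ u₀ θ₀ N (Φ N) ≪ liouville (Torus.geometry (Fin 3)) (N + 1) (hsDiameter σ N) :=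
      localGibbsLaw_absolutelyContinuous σ a₀ u₀ θ₀ N (Φ N)
    have hstep1 : localGibbsLaw σ a₀ u₀ θ₀ N (Φ N) {z | (L : ℝ) * Θ
          ≤ warmIntake (hsDiameter σ N) (fun r => (Φ N).flow r z) Θ i s}
        ≤ localGibbsLaw σ a₀ u₀ θ₀ N (Φ N) {z | (L : ℝ) * Θ ≤ ‖((Φ N).flow s z i).2‖ ^ 2} := by
      refine measure_mono_ae ?_
      have hpart : ∀ᵐ z ∂(localGibbsLaw σ a₀ u₀ θ₀ N (Φ N)),
          ¬ Participates (Torus.geometry (Fin 3)) (hsDiameter σ N) ((Φ N).flow s z) i := by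
        rw [ae_iff]
        simpa only [not_not] using
          measure_participates_flow_eq_zero (hsDiameter_pos hσ N).ne' (Φ N) _ hPac s i
      filter_upwards [ae_mem_good_localGibbsLaw σ a₀ u₀ θ₀ N (Φ N), hpart] with z hz hnp
      intro hzΛ
      have hdom := warmIntake_le_energy_zero hL hσ hσ2 (Φ N) hz i hs0 hΘ.le
      have hE0 := ((hL σ N (Φ N)).1 z hz i s hs0).2.2.2.2.2.2.1 hnp
      show (L : ℝ) * Θ ≤ ‖((Φ N).flow s z i).2‖ ^ 2
      exact hE0 ▸ le_trans hzΛ hdom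
    have hstep2 : localGibbsLaw σ a₀ u₀ θ₀ N (Φ N) {z | (L : ℝ) * Θ ≤ ‖((Φ N).flow s z i).2‖ ^ 2}
        ≤ ENNReal.ofReal (max B 0 / (L : ℝ) ^ p) := by
      have hN1 : ((N : ℝ≥0∞) + 1) ≠ 0 := by positivity
      rw [← ENNReal.mul_le_mul_iff_right hN1 (by simp), card_mul_measure_level_le_eq_census a₀ θ₀ u₀ (Φ N) s _ i]
      refine (hcen N hN s hs L hL1).trans ?_
      have hN3 : ((N : ℝ≥0∞) + 1) = ENNReal.ofReal ((N : ℝ) + 1) := by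
        rw [ENNReal.ofReal_add (by positivity) zero_le_one, ENNReal.ofReal_natCast, ENNReal.ofReal_one]
      rw [hN3, ← ENNReal.ofReal_mul (by positivity)]
      refine ENNReal.ofReal_le_ofReal ?_
      have hN4 : (0 : ℝ) < (N : ℝ) + 1 := by positivity
      have hLp : (0 : ℝ) < (L : ℝ) ^ p := by positivity
      have key : B * ((N : ℝ) + 1) / (L : ℝ) ^ p = ((N : ℝ) + 1) * (B / (L : ℝ) ^ p) := by ring
      rw [key]
      exact mul_le_mul_of_nonneg_left (div_le_div_of_nonneg_right (le_max_left B 0) hLp.le) hN4.le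
    exact hstep1.trans hstep2

/-- **Corollary**: the order-5 census decay implies the registered merge-intake stub statement outright (the sure ledger
has landed: `stub_lineageLedgerSure`). -/
theorem mergeIntakeTails_of_censusDecayOrder_five : CensusDecayOrder 5 → MergeIntakeTails :=
  fun hC => mergeIntakeTails_iff_order_five.2 (mergeIntakeTailsOrder_of_censusDecayOrder 5 stub_lineageLedgerSure hC)

/-- **Corollary**: the line's own transfer statement `CensusDecay` implies the merge-intake tails of order 4 — the
order the landed census assembly actually consumes (up to constants); so modulo `NeutralRunTails`, the data facts and
the ledger, the merge channel at order 4 is EQUIVALENT to `CensusDecay`. -/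
theorem mergeIntakeTailsOrder_four_of_censusDecay : CensusDecay → MergeIntakeTailsOrder 4 :=
  fun hC => mergeIntakeTailsOrder_of_censusDecayOrder 4 stub_lineageLedgerSure (censusDecay_iff_order_four.1 hC)

end Summit.AtomisticToContinuum.HydrodynamicLimit.Theorems.EnergyCurrentTailsPedigree

end
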